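import Mathlib.Order.Filter.Extr
import Mathlib.Data.Real.Basic
import Mathlib.Data.Finset.Basic
import Mathlib.Tactic.Linarith
import HarnessLib

/-!
# A "sufficiently large" penalty coefficient makes the QUBO reformulation exact (finite feasible sets)

Topic `Combinatorics/Optimization`.  PUBLISHED STATEMENT with our proof, with the printed phrase
"sufficiently large" replaced by an explicit sufficient threshold; one definition (the penalised
objective) and NO named fact (D-0026).  The tree's `Analysis/Convex/ExactPenaltyFunctions.lean`
(Di Pillo–Grippo, continuous exact penalties) and `Algebra/Polynomial/RelaxedHessianPenaltyLemma.lean`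
are unrelated continuous ∕ matrix statements; nothing in the tree treats the finite QUBO penalty
reformulation (`lean search 'penalised|penalized|qubo|QUBO'`).

HONEST FRAMING: instance-level adjudication of specific advantage claims; no claim about BQP vs BPP
or the summit.

## Source (read on the materialised text) and what is taken

O. Şeker, N. Tanoumand, M. Bodur, *Digital Annealer for quadratic unconstrained binary optimization:
A comparative performance analysis*, Applied Soft Computing **127**, 109367 (2022) = arXiv:2012.12264
[SekerTanoumandBodur2022], §2.2 "QUBO approach" (held text `paper:arxiv-2012.12264`, p0007 L5–L21):
the constrained model `min cᵀx + xᵀQx s.t. Ax = b, x ∈ {0,1}ⁿ` is reformulated as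
`min cᵀx + xᵀQx + λ (Ax − b)ᵀ(Ax − b), x ∈ {0,1}ⁿ`, "where `λ > 0` is a large number representing
the unit penalty cost for constraint violation. … If the penalty coefficient `λ` is chosen
'sufficiently large', the model (QUBO) is an exact reformulation of (the constrained model), in the
sense that any feasible solution … yields a smaller objective value in (the QUBO objective) than any
binary infeasible solution due to a large penalty term. Hence, if (the constrained model) has an
optimal solution, then its optimal solution set and optimal objective value coincide with the ones of
(QUBO)."

## What is formalised (abstractly: a finite search space `S : Finset α` — for QUBO `α = {0,1}ⁿ` —
## an objective `f`, a violation measure `v ≥ 0` with `v x = 0 ⇔ x feasible` — for QUBO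
## `v x = ‖Ax − b‖²` — and the penalised objective `f + λ·v`)

* `penalised f v λ x = f x + λ · v x` (def), `penalised_of_feasible`;
* **`penalised_lt_of_infeasible`** — the printed "sense": with an EXPLICIT threshold
  (`M − m < λ δ`, where `M` bounds `f` above on feasible points, `m` bounds `f` below on `S`, and
  `0 < δ ≤ v x` on infeasible points — for integer data `δ = 1`), every feasible point has a strictly
  smaller penalised value than every infeasible point;
* **`feasible_of_isMinOn_penalised`**, **`isMinOn_feasible_of_isMinOn_penalised`**,
  **`isMinOn_penalised_of_isMinOn_feasible`** — "its optimal solution set … coincide[s] with the ones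
  of (QUBO)": the minimisers of the penalised objective over `S` are exactly the minimisers of `f` over
  the feasible subset (assuming a feasible point exists), and
* `penalised_eq_of_isMinOn` — "… and optimal objective value coincide": at such a minimiser the two
  objective values agree.

NOT formalised: the matrix form `(Ax − b)ᵀ(Ax − b)` itself (any nonnegative violation measure
vanishing exactly on the feasible set is allowed), inequality constraints with slack variables, how
to CHOOSE `λ` in practice (the paper's "acceptable values are often much smaller"), annealer dynamics.

Context (cell pub-qadeq, lane spoof-1): every QUBO ∕ annealer accounting row (A-1484 Pasqal Benders
'constructive penalty tuning', A-1470 QCQO, the MIS ∕ UDG QUBO rows) rests on this reformulation; the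
lane cites the explicit threshold instead of "sufficiently large".
-/

namespace Literature.Combinatorics.Optimization.QUBOPenalty

variable {α : Type*}

/-- The penalised (QUBO) objective `f + λ·v`. [cite: SekerTanoumandBodur2022, §2.2 (QUBO model)] -/
def penalised (f v : α → ℝ) (lam : ℝ) : α → ℝ := fun x => f x + lam * v x

/-- Unfolding lemma. [cite: SekerTanoumandBodur2022, §2.2 (QUBO model)] -/
theorem penalised_apply (f v : α → ℝ) (lam : ℝ) (x : α) :
    penalised f v lam x = f x + lam * v x := rfl

/-- On a feasible point (`v x = 0`) the penalised objective is the original objective.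
[cite: SekerTanoumandBodur2022, §2.2] -/
theorem penalised_of_feasible (f v : α → ℝ) (lam : ℝ) {x : α} (hx : v x = 0) :
    penalised f v lam x = f x := by
  rw [penalised_apply, hx, mul_zero, add_zero]

/-- **"Sufficiently large", made explicit**: if `f ≤ M` on feasible points of `S`, `m ≤ f` on `S`,
every infeasible point of `S` violates by at least `δ`, and `M − m < λ δ` with `λ ≥ 0`, then "any
feasible solution … yields a smaller objective value in (QUBO) than any binary infeasible solution".
[cite: SekerTanoumandBodur2022, §2.2 ("If the penalty coefficient is chosen 'sufficiently large' …")] -/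
theorem penalised_lt_of_infeasible {S : Finset α} {f v : α → ℝ} {lam δ M m : ℝ}
    (hδ : ∀ x ∈ S, v x ≠ 0 → δ ≤ v x) (hM : ∀ y ∈ S, v y = 0 → f y ≤ M) (hm : ∀ x ∈ S, m ≤ f x)
    (hlam : M - m < lam * δ) (hlam0 : 0 ≤ lam)
    {x y : α} (hy : y ∈ S) (hyf : v y = 0) (hx : x ∈ S) (hxi : v x ≠ 0) :
    penalised f v lam y < penalised f v lam x := by
  rw [penalised_of_feasible f v lam hyf, penalised_apply]
  have h1 := hM y hy hyf
  have h2 := hm x hx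
  have h3 : lam * δ ≤ lam * v x := mul_le_mul_of_nonneg_left (hδ x hx hxi) hlam0
  linarith

/-- **Minimisers of the penalised objective are feasible** (when a feasible point exists).
[cite: SekerTanoumandBodur2022, §2.2 ("its optimal solution set … coincide")] -/
theorem feasible_of_isMinOn_penalised {S : Finset α} {f v : α → ℝ} {lam δ M m : ℝ}
    (hδ : ∀ x ∈ S, v x ≠ 0 → δ ≤ v x) (hM : ∀ y ∈ S, v y = 0 → f y ≤ M) (hm : ∀ x ∈ S, m ≤ f x)
    (hlam : M - m < lam * δ) (hlam0 : 0 ≤ lam) {y : α} (hy : y ∈ S) (hyf : v y = 0)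
    {x : α} (hx : x ∈ S) (hmin : IsMinOn (penalised f v lam) ↑S x) : v x = 0 := by
  by_contra hxi
  have hlt := penalised_lt_of_infeasible hδ hM hm hlam hlam0 hy hyf hx hxi
  have hle := hmin hy
  exact absurd hle (not_le.2 hlt)

/-- **… and they minimise the original objective over the feasible set.**
[cite: SekerTanoumandBodur2022, §2.2 ("its optimal solution set … coincide")] -/
theorem isMinOn_feasible_of_isMinOn_penalised {S : Finset α} {f v : α → ℝ} {lam δ M m : ℝ}
    (hδ : ∀ x ∈ S, v x ≠ 0 → δ ≤ v x) (hM : ∀ y ∈ S, v y = 0 → f y ≤ M) (hm : ∀ x ∈ S, m ≤ f x)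
    (hlam : M - m < lam * δ) (hlam0 : 0 ≤ lam) {y : α} (hy : y ∈ S) (hyf : v y = 0)
    {x : α} (hx : x ∈ S) (hmin : IsMinOn (penalised f v lam) ↑S x) :
    IsMinOn f {z | z ∈ S ∧ v z = 0} x := by
  have hxf := feasible_of_isMinOn_penalised hδ hM hm hlam hlam0 hy hyf hx hmin
  intro z hz
  obtain ⟨hzS, hzf⟩ := hz
  have h := hmin hzS
  simp only [Set.mem_setOf_eq] at h ⊢
  rwa [penalised_of_feasible f v lam hxf, penalised_of_feasible f v lam hzf] at h

/-- **Conversely, a feasible minimiser of the original objective minimises the penalised objective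
over the whole search space.** [cite: SekerTanoumandBodur2022, §2.2 ("its optimal solution set …
coincide")] -/
theorem isMinOn_penalised_of_isMinOn_feasible {S : Finset α} {f v : α → ℝ} {lam δ M m : ℝ}
    (hδ : ∀ x ∈ S, v x ≠ 0 → δ ≤ v x) (hM : ∀ y ∈ S, v y = 0 → f y ≤ M) (hm : ∀ x ∈ S, m ≤ f x)
    (hlam : M - m < lam * δ) (hlam0 : 0 ≤ lam)
    {x : α} (hx : x ∈ S) (hxf : v x = 0) (hmin : IsMinOn f {z | z ∈ S ∧ v z = 0} x) :
    IsMinOn (penalised f v lam) ↑S x := by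
  intro z hzS
  simp only [Finset.mem_coe] at hzS
  simp only [Set.mem_setOf_eq]
  by_cases hzf : v z = 0
  · have h := hmin ⟨hzS, hzf⟩
    simp only [Set.mem_setOf_eq] at h
    rw [penalised_of_feasible f v lam hxf, penalised_of_feasible f v lam hzf]
    exact h
  · exact le_of_lt (penalised_lt_of_infeasible hδ hM hm hlam hlam0 hx hxf hzS hzf)

/-- **Optimal values coincide**: at a minimiser of the penalised objective the penalty vanishes, so
the optimal QUBO value equals the optimal constrained value. [cite: SekerTanoumandBodur2022, §2.2
("… and optimal objective value coincide")] -/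
theorem penalised_eq_of_isMinOn {S : Finset α} {f v : α → ℝ} {lam δ M m : ℝ}
    (hδ : ∀ x ∈ S, v x ≠ 0 → δ ≤ v x) (hM : ∀ y ∈ S, v y = 0 → f y ≤ M) (hm : ∀ x ∈ S, m ≤ f x)
    (hlam : M - m < lam * δ) (hlam0 : 0 ≤ lam) {y : α} (hy : y ∈ S) (hyf : v y = 0)
    {x : α} (hx : x ∈ S) (hmin : IsMinOn (penalised f v lam) ↑S x) :
    penalised f v lam x = f x :=
  penalised_of_feasible f v lam (feasible_of_isMinOn_penalised hδ hM hm hlam hlam0 hy hyf hx hmin)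

end Literature.Combinatorics.Optimization.QUBOPenalty
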